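import Mathlib
import Summits.KontsevichZagierPeriods.KontsevichZagierPeriods.Theorems.SoloInformedLegendreKillA
import Literature.NumberTheory.Transcendental.KZSemiCanonicalReductionProofs
import HarnessLib
import HarnessLib.Audit

/-!
# Legendre's relation by moves, IV: the exact form is a relation (solo-informed, s33)

On the homotopy band `H = (0,1)² × [0, μ]` (coordinates `w = (s, t, m)`, `μ ∈ (0,1)` real
algebraic) the modulus derivative `∂_m F` of the Legendre integrand
`F = (1 − m s² − m't²) k`, `m' = 1 − m`, equals `∂_s A + ∂_t B` (the certificate of file I).
File III killed `∂_s A`; here **`[H, ∂_t B]` is a relation** — Newton–Leibniz along the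
`t`-fibre with `B(0) = B(1) = 0` over the base `(0,1) × (0, μ]` (the corner `m = 0, t = 1`, where
`B` is discontinuous, is removed and restored by a null-set move) — and hence every representation
`[H, ∂_m F]` is a relation (`soloInformed_legendre_exact`): the "exactness ⇒ relation" half of
THEOREM XVII.  File V runs the homotopy in `m`.

References: M. Kontsevich, D. Zagier, *Periods* (2001), §1.2; this work (solo-informed s33).
-/

noncomputable section

open MeasureTheory Set Filter
open scoped Classical

open Literature.NumberTheory.Transcendental Literature.NumberTheory.Transcendental.KZ
open Literature.ModelTheory.ExponentialFields

namespace Summit.KontsevichZagierPeriods.KontsevichZagierPeriods.Theorems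

/-! ### The kill of `∂_t B` -/

/-- **`[H, ∂_t B] ∼ 0`.**  There is a representation on the homotopy band `H = (0,1)² × [0,μ]`
with integrand `∂_t B = −½s²[1 − 2t² + m't²(1−t²)/(1−m't²)]·k` (`m' = 1 − m`) whose class is a
relation: on the band `(0,1) × [0,μ] × [0,1]` (coordinates `(s, m, t)`) the primitive
`B = −½s²·t(1−t²)·k` vanishes at `t = 0, 1`; Newton–Leibniz in `t`, open fibres, swap coordinates.
[this work] -/
theorem soloInformed_legendre_killB (μ : ℝ) (hμ : μ ∈ Ioo (0:ℝ) 1) (hμa : IsAlgebraic ℚ μ) :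
    ∃ T : IntegralRep 3,
      T.domain = KZlog.band {z : Fin 2 → ℝ | z 0 ∈ Ioo (0:ℝ) 1 ∧ z 1 ∈ Ioo (0:ℝ) 1}
        (fun _ => 0) (fun _ => μ) ∧
      (∀ w, T.integrand w =
        -(w 0 ^ 2 / 2) * (1 - 2 * w 1 ^ 2 + (1 - w 2) * w 1 ^ 2 * (1 - w 1 ^ 2) /
            (1 - (1 - w 2) * w 1 ^ 2)) *
          ((√(1 - w 0 ^ 2))⁻¹ * (√(1 - w 2 * w 0 ^ 2))⁻¹ *
            ((√(1 - w 1 ^ 2))⁻¹ * (√(1 - (1 - w 2) * w 1 ^ 2))⁻¹))) ∧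
      of T ∈ relations := by
  have snoc0 : ∀ (x : Fin 2 → ℝ) (c : ℝ), (Fin.snoc x c : Fin 3 → ℝ) 0 = x 0 := fun _ _ => rfl
  have snoc1 : ∀ (x : Fin 2 → ℝ) (c : ℝ), (Fin.snoc x c : Fin 3 → ℝ) 1 = x 1 := fun _ _ => rfl
  have snoc2 : ∀ (x : Fin 2 → ℝ) (c : ℝ), (Fin.snoc x c : Fin 3 → ℝ) 2 = c := fun _ _ => rfl
  have hμ1 : μ < 1 := hμ.2
  -- the base `(0,1) × (0, μ]` (the face `m = 0` removed: there `B` is not continuous at `t = 1`)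
  have hpos1 : IsSemialgebraic ℚ {y : Fin 2 → ℝ | 0 < y 1} := by
    have h := isSemialgebraic_setOf_eval_pos (k := ℚ) (R := ℝ)
      (MvPolynomial.X 1 : MvPolynomial (Fin 2) ℚ)
    have hset : {x : Fin 2 → ℝ | 0 < MvPolynomial.aeval x
        (MvPolynomial.X 1 : MvPolynomial (Fin 2) ℚ)} = {y | 0 < y 1} := by
      ext y; simp only [mem_setOf_eq, MvPolynomial.aeval_X]
    rw [hset] at h
    exact h
  have hbase : IsSemialgebraic ℚ (KZlog.band {y : Fin 1 → ℝ | y 0 ∈ Ioo (0:ℝ) 1} (fun _ => 0) (fun _ => μ) ∩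
        {y : Fin 2 → ℝ | 0 < y 1}) :=
    (soloInformed_legendre_isSemialgebraic_base hμa).inter hpos1
  have hband' : IsSemialgebraic ℚ (KZlog.band (KZlog.band {y : Fin 1 → ℝ | y 0 ∈ Ioo (0:ℝ) 1} (fun _ => 0) (fun _ => μ) ∩
        {y : Fin 2 → ℝ | 0 < y 1}) (fun _ => 0) (fun _ => 1)) :=
    KZlog.isSemialgebraic_band (isSemialgebraicFunOn_const_of_isAlgebraic hbase isAlgebraic_zero)
      (isSemialgebraicFunOn_const_of_isAlgebraic hbase isAlgebraic_one)
  have hmem_base : ∀ y : Fin 2 → ℝ, y ∈ (KZlog.band {y : Fin 1 → ℝ | y 0 ∈ Ioo (0:ℝ) 1} (fun _ => 0) (fun _ => μ) ∩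
        {y : Fin 2 → ℝ | 0 < y 1}) ↔
      y 0 ∈ Ioo (0:ℝ) 1 ∧ 0 < y 1 ∧ y 1 ≤ μ := by
    intro y
    rw [mem_inter_iff, soloInformed_legendre_mem_base, mem_setOf_eq]
    constructor
    · rintro ⟨⟨h0, -, h2⟩, h3⟩; exact ⟨h0, h3, h2⟩
    · rintro ⟨h0, h3, h2⟩; exact ⟨⟨h0, h3.le, h2⟩, h3⟩
  have hmem_band : ∀ u : Fin 3 → ℝ, u ∈ (KZlog.band (KZlog.band {y : Fin 1 → ℝ | y 0 ∈ Ioo (0:ℝ) 1} (fun _ => 0) (fun _ => μ) ∩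
        {y : Fin 2 → ℝ | 0 < y 1}) (fun _ => 0) (fun _ => 1)) ↔
      u 0 ∈ Ioo (0:ℝ) 1 ∧ (0 < u 1 ∧ u 1 ≤ μ) ∧ 0 ≤ u 2 ∧ u 2 ≤ 1 := by
    intro u
    have h2 : (Fin.last 2 : Fin 3) = 2 := rfl
    have h3 : ((1 : Fin 2).castSucc : Fin 3) = 1 := rfl
    rw [KZlog.mem_band, hmem_base]
    simp only [Fin.init, Fin.castSucc_zero, h2, h3, and_assoc]
  have hw' : ∀ u ∈ (KZlog.band (KZlog.band {y : Fin 1 → ℝ | y 0 ∈ Ioo (0:ℝ) 1} (fun _ => 0) (fun _ => μ) ∩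
        {y : Fin 2 → ℝ | 0 < y 1}) (fun _ => 0) (fun _ => 1)),
      (0 ≤ u 0 ∧ u 0 ≤ 1) ∧ (0 ≤ u 2 ∧ u 2 ≤ 1) ∧ 0 ≤ u 1 ∧ u 1 < 1 := by
    intro u hu
    rw [hmem_band] at hu
    exact ⟨⟨hu.1.1.le, hu.1.2.le⟩, hu.2.2, hu.2.1.1.le, hu.2.1.2.trans_lt hμ1⟩
  have hden : ∀ u ∈ (KZlog.band (KZlog.band {y : Fin 1 → ℝ | y 0 ∈ Ioo (0:ℝ) 1} (fun _ => 0) (fun _ => μ) ∩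
        {y : Fin 2 → ℝ | 0 < y 1}) (fun _ => 0) (fun _ => 1)), 0 < 1 - (1 - u 1) * u 2 ^ 2 := by
    intro u hu
    rw [hmem_band] at hu
    have : (1 - u 1) * u 2 ^ 2 ≤ (1 - u 1) * 1 :=
      mul_le_mul_of_nonneg_left (by nlinarith [hu.2.2.1, hu.2.2.2]) (by linarith [hu.2.1.2])
    nlinarith [hu.2.1.1]
  have hP : IsSemialgebraicFunOn ℚ (KZlog.band (KZlog.band {y : Fin 1 → ℝ | y 0 ∈ Ioo (0:ℝ) 1} (fun _ => 0) (fun _ => μ) ∩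
        {y : Fin 2 → ℝ | 0 < y 1}) (fun _ => 0) (fun _ => 1))
      (fun u => -(u 0 ^ 2 / 2) * (u 2 * (1 - u 2 ^ 2)) *
        ((√(1 - u 0 ^ 2))⁻¹ * (√(1 - u 1 * u 0 ^ 2))⁻¹ *
          ((√(1 - u 2 ^ 2))⁻¹ * (√(1 - (1 - u 1) * u 2 ^ 2))⁻¹))) := by
    refine soloInformed_legendre_sa_mul_kernel 0 2 1 hband' hw' ?_
    refine (IsSemialgebraicFunOn.mul_holds (isSemialgebraicFunOn_ratCast hband' (-1/2))
      (isSemialgebraicFunOn_aeval hband' (MvPolynomial.X 0 ^ 2 *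
        (MvPolynomial.X 2 * (1 - MvPolynomial.X 2 ^ 2))))).congr fun u _ => ?_
    simp only [Pi.mul_apply, map_mul, map_sub, map_pow, map_one, MvPolynomial.aeval_X]
    push_cast
    ring
  have hg : IsSemialgebraicFunOn ℚ (KZlog.band (KZlog.band {y : Fin 1 → ℝ | y 0 ∈ Ioo (0:ℝ) 1} (fun _ => 0) (fun _ => μ) ∩
        {y : Fin 2 → ℝ | 0 < y 1}) (fun _ => 0) (fun _ => 1))
      (fun u => -(u 0 ^ 2 / 2) * (1 - 2 * u 2 ^ 2 + (1 - u 1) * u 2 ^ 2 * (1 - u 2 ^ 2) /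
          (1 - (1 - u 1) * u 2 ^ 2)) *
        ((√(1 - u 0 ^ 2))⁻¹ * (√(1 - u 1 * u 0 ^ 2))⁻¹ *
          ((√(1 - u 2 ^ 2))⁻¹ * (√(1 - (1 - u 1) * u 2 ^ 2))⁻¹))) := by
    refine soloInformed_legendre_sa_mul_kernel 0 2 1 hband' hw' ?_
    have hq : ∀ u ∈ (KZlog.band (KZlog.band {y : Fin 1 → ℝ | y 0 ∈ Ioo (0:ℝ) 1} (fun _ => 0) (fun _ => μ) ∩
        {y : Fin 2 → ℝ | 0 < y 1}) (fun _ => 0) (fun _ => 1)),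
        MvPolynomial.aeval u (1 - (1 - MvPolynomial.X 1) * MvPolynomial.X 2 ^ 2 :
          MvPolynomial (Fin 3) ℚ) ≠ 0 := by
      intro u hu
      have := hden u hu
      simp only [map_sub, map_one, map_mul, map_pow, MvPolynomial.aeval_X]
      exact this.ne'
    refine (IsSemialgebraicFunOn.mul_holds
      (IsSemialgebraicFunOn.mul_holds (isSemialgebraicFunOn_ratCast hband' (-1/2))
        (isSemialgebraicFunOn_aeval hband' (MvPolynomial.X 0 ^ 2)))
      (IsSemialgebraicFunOn.add_holds
        (isSemialgebraicFunOn_aeval hband' (1 - 2 * MvPolynomial.X 2 ^ 2))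
        (isSemialgebraicFunOn_aeval_div_aeval hband'
          ((1 - MvPolynomial.X 1) * MvPolynomial.X 2 ^ 2 * (1 - MvPolynomial.X 2 ^ 2))
          (1 - (1 - MvPolynomial.X 1) * MvPolynomial.X 2 ^ 2) hq))).congr fun u _ => ?_
    simp only [Pi.mul_apply, Pi.add_apply, map_mul, map_sub, map_pow, map_one, map_ofNat,
      MvPolynomial.aeval_X]
    push_cast
    ring
  have hcont : ∀ y ∈ (KZlog.band {y : Fin 1 → ℝ | y 0 ∈ Ioo (0:ℝ) 1} (fun _ => 0) (fun _ => μ) ∩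
        {y : Fin 2 → ℝ | 0 < y 1}),
      ContinuousOn (fun b : ℝ => (fun u : Fin 3 → ℝ => -(u 0 ^ 2 / 2) * (u 2 * (1 - u 2 ^ 2)) *
        ((√(1 - u 0 ^ 2))⁻¹ * (√(1 - u 1 * u 0 ^ 2))⁻¹ *
          ((√(1 - u 2 ^ 2))⁻¹ * (√(1 - (1 - u 1) * u 2 ^ 2))⁻¹))) (Fin.snoc y b)) (Icc 0 1) := by
    intro y hy
    rw [hmem_base] at hy
    have hrad : ∀ b ∈ Icc (0:ℝ) 1, 0 < 1 - (1 - y 1) * b ^ 2 := by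
      intro b hb
      have : (1 - y 1) * b ^ 2 ≤ (1 - y 1) * 1 :=
        mul_le_mul_of_nonneg_left (by nlinarith [hb.1, hb.2]) (by linarith [hy.2.2])
      nlinarith [hy.2.1]
    have h1 : Continuous fun b : ℝ => -(y 0 ^ 2 / 2) * (b * √(1 - b ^ 2)) :=
      continuous_const.mul (continuous_id.mul
        (Real.continuous_sqrt.comp (continuous_const.sub (continuous_pow 2))))
    have h2 : ContinuousOn (fun b : ℝ => (√(1 - (1 - y 1) * b ^ 2))⁻¹) (Icc 0 1) :=
      ContinuousOn.inv₀ (Real.continuous_sqrt.comp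
        (continuous_const.sub (continuous_const.mul (continuous_pow 2)))).continuousOn
        fun b hb => (Real.sqrt_pos.2 (hrad b hb)).ne'
    have hc : ContinuousOn (fun b : ℝ => -(y 0 ^ 2 / 2) * (b * √(1 - b ^ 2)) *
        (((√(1 - y 0 ^ 2))⁻¹ * (√(1 - y 1 * y 0 ^ 2))⁻¹) * (√(1 - (1 - y 1) * b ^ 2))⁻¹))
        (Icc 0 1) :=
      h1.continuousOn.mul (continuousOn_const.mul h2)
    refine hc.congr fun b _ => ?_
    simp only [snoc0, snoc1, snoc2]
    rw [← soloInformed_mul_one_sub_sq_mul_inv_sqrt b]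
    ring
  have hder : ∀ y ∈ (KZlog.band {y : Fin 1 → ℝ | y 0 ∈ Ioo (0:ℝ) 1} (fun _ => 0) (fun _ => μ) ∩
        {y : Fin 2 → ℝ | 0 < y 1}),
      ∀ b ∈ Ioo (0:ℝ) 1, HasDerivAt (fun b : ℝ => (fun u : Fin 3 → ℝ => -(u 0 ^ 2 / 2) *
        (u 2 * (1 - u 2 ^ 2)) * ((√(1 - u 0 ^ 2))⁻¹ * (√(1 - u 1 * u 0 ^ 2))⁻¹ *
          ((√(1 - u 2 ^ 2))⁻¹ * (√(1 - (1 - u 1) * u 2 ^ 2))⁻¹))) (Fin.snoc y b))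
        ((fun u : Fin 3 → ℝ => -(u 0 ^ 2 / 2) *
          (1 - 2 * u 2 ^ 2 + (1 - u 1) * u 2 ^ 2 * (1 - u 2 ^ 2) / (1 - (1 - u 1) * u 2 ^ 2)) *
          ((√(1 - u 0 ^ 2))⁻¹ * (√(1 - u 1 * u 0 ^ 2))⁻¹ *
          ((√(1 - u 2 ^ 2))⁻¹ * (√(1 - (1 - u 1) * u 2 ^ 2))⁻¹))) (Fin.snoc y b)) b := by
    intro y hy b hb
    rw [hmem_base] at hy
    have key := soloInformed_legendre_hasDerivAt_t (s := y 0) (t := b) (m := y 1) hb hy.2.1.le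
      (hy.2.2.trans_lt hμ1)
    simp only [snoc0, snoc1, snoc2]
    exact key
  have hint : IntegrableOn (fun u : Fin 3 → ℝ => -(u 0 ^ 2 / 2) *
      (1 - 2 * u 2 ^ 2 + (1 - u 1) * u 2 ^ 2 * (1 - u 2 ^ 2) / (1 - (1 - u 1) * u 2 ^ 2)) *
      ((√(1 - u 0 ^ 2))⁻¹ * (√(1 - u 1 * u 0 ^ 2))⁻¹ *
          ((√(1 - u 2 ^ 2))⁻¹ * (√(1 - (1 - u 1) * u 2 ^ 2))⁻¹)))
      (KZlog.band (KZlog.band {y : Fin 1 → ℝ | y 0 ∈ Ioo (0:ℝ) 1} (fun _ => 0) (fun _ => μ) ∩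
        {y : Fin 2 → ℝ | 0 < y 1}) (fun _ => 0) (fun _ => 1)) := by
    refine soloInformed_integrableOn_of_le_inv_sqrt_prod hband' hg ∅ {0} {1} {0, 2}
      (2 * (2 + (1 - μ)⁻¹) * (√(1 - μ))⁻¹)
      ({u | u 2 = 0} ∪ {u | u 2 = 1})
      (measure_union_null (by rw [volume_pi]; exact Measure.pi_hyperplane _ 2 0)
        (by rw [volume_pi]; exact Measure.pi_hyperplane _ 2 1))
      (fun u hu hZ j => ?_) (fun u hu hc => ?_)
    · rw [hmem_band] at hu
      simp only [mem_union, mem_setOf_eq, not_or] at hZ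
      fin_cases j
      · exact hu.1
      · exact ⟨hu.2.1.1, hu.2.1.2.trans_lt hμ1⟩
      · exact ⟨lt_of_le_of_ne hu.2.2.1 (Ne.symm hZ.1), lt_of_le_of_ne hu.2.2.2 hZ.2⟩
    · rw [hmem_band] at hu
      have hs := hc 0
      have ht := hc 2
      have hm := hc 1
      obtain ⟨-, -, hB⟩ := soloInformed_legendre_factors_le (s := u 0) (t := u 2) (m := u 1)
        (μ := μ) hs ht hm.1.le hu.2.1.2 hμ1
      have hK := soloInformed_legendre_kernel_le (s := u 0) (t := u 2) (m := u 1) (μ := μ)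
        hs ht hm.1 hu.2.1.2 hμ1
      have hK0 : 0 ≤ (√(1 - u 0 ^ 2))⁻¹ * (√(1 - u 1 * u 0 ^ 2))⁻¹ *
          ((√(1 - u 2 ^ 2))⁻¹ * (√(1 - (1 - u 1) * u 2 ^ 2))⁻¹) := by positivity
      have hC0 : 0 ≤ 2 + (1 - μ)⁻¹ := add_nonneg zero_le_two (inv_nonneg.2 (by linarith))
      rw [abs_mul, abs_of_nonneg hK0, Finset.prod_empty, Finset.prod_singleton,
        Finset.prod_singleton, Finset.prod_pair (by decide)]
      calc |-(u 0 ^ 2 / 2) * (1 - 2 * u 2 ^ 2 + (1 - u 1) * u 2 ^ 2 * (1 - u 2 ^ 2) /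
              (1 - (1 - u 1) * u 2 ^ 2))| *
            ((√(1 - u 0 ^ 2))⁻¹ * (√(1 - u 1 * u 0 ^ 2))⁻¹ *
              ((√(1 - u 2 ^ 2))⁻¹ * (√(1 - (1 - u 1) * u 2 ^ 2))⁻¹))
          ≤ (2 + (1 - μ)⁻¹) * ((√(1 - μ))⁻¹ * (2 * (√(1 - u 0))⁻¹ +
              2 * ((√(1 - u 0))⁻¹ * (√(1 - u 2))⁻¹ * (√(u 1))⁻¹))) :=
            mul_le_mul hB hK hK0 hC0
        _ = 2 * (2 + (1 - μ)⁻¹) * (√(1 - μ))⁻¹ * (1 * (√(1 - u 0))⁻¹ +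
              (√(u 1))⁻¹ * ((√(1 - u 0))⁻¹ * (√(1 - u 2))⁻¹)) := by ring
  have h0 : ∀ y ∈ (KZlog.band {y : Fin 1 → ℝ | y 0 ∈ Ioo (0:ℝ) 1} (fun _ => 0) (fun _ => μ) ∩
        {y : Fin 2 → ℝ | 0 < y 1}),
      (fun u : Fin 3 → ℝ => -(u 0 ^ 2 / 2) * (u 2 * (1 - u 2 ^ 2)) *
        ((√(1 - u 0 ^ 2))⁻¹ * (√(1 - u 1 * u 0 ^ 2))⁻¹ *
          ((√(1 - u 2 ^ 2))⁻¹ * (√(1 - (1 - u 1) * u 2 ^ 2))⁻¹))) (Fin.snoc y 1) -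
      (fun u : Fin 3 → ℝ => -(u 0 ^ 2 / 2) * (u 2 * (1 - u 2 ^ 2)) *
        ((√(1 - u 0 ^ 2))⁻¹ * (√(1 - u 1 * u 0 ^ 2))⁻¹ *
          ((√(1 - u 2 ^ 2))⁻¹ * (√(1 - (1 - u 1) * u 2 ^ 2))⁻¹))) (Fin.snoc y 0) = 0 := by
    intro y _
    simp [snoc1, snoc2]
  obtain ⟨T, hTd, hTi, hT⟩ := soloInformed_legendre_kill _ hbase _ _ hP hg hcont hder hint h0
    (Equiv.swap 1 2)
  have he0 : (Equiv.swap (1 : Fin 3) 2) 0 = 0 := by decide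
  have he1 : (Equiv.swap (1 : Fin 3) 2) 1 = 2 := by decide
  have he2 : (Equiv.swap (1 : Fin 3) 2) 2 = 1 := by decide
  -- `T` lives on `H⁺ = (0,1)² × (0, μ]`; move it to `H = (0,1)² × [0, μ]` (a null face added)
  have hTd' : T.domain = {w : Fin 3 → ℝ | (w 0 ∈ Ioo (0:ℝ) 1 ∧ w 1 ∈ Ioo (0:ℝ) 1) ∧
      0 < w 2 ∧ w 2 ≤ μ} := by
    rw [hTd]
    ext w
    have h2 : (Fin.last 2 : Fin 3) = 2 := rfl
    have h3 : ((1 : Fin 2).castSucc : Fin 3) = 1 := rfl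
    have h1 : (Fin.last 1 : Fin 2) = 1 := rfl
    simp only [mem_setOf_eq, mem_inter_iff, KZlog.mem_band, Fin.init, Fin.castSucc_zero, h1, h2,
      h3, he0, he1, he2, mem_Ioo, and_assoc]
    constructor
    · rintro ⟨h0, h0', -, h2', h3', h4, h4'⟩; exact ⟨h0, h0', h4, h4', h3', h2'⟩
    · rintro ⟨h0, h0', h4, h4', h3', h2'⟩; exact ⟨h0, h0', h3'.le, h2', h3', h4, h4'⟩
  have hTi' : ∀ w, T.integrand w =
      -(w 0 ^ 2 / 2) * (1 - 2 * w 1 ^ 2 + (1 - w 2) * w 1 ^ 2 * (1 - w 1 ^ 2) /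
          (1 - (1 - w 2) * w 1 ^ 2)) *
        ((√(1 - w 0 ^ 2))⁻¹ * (√(1 - w 2 * w 0 ^ 2))⁻¹ *
            ((√(1 - w 1 ^ 2))⁻¹ * (√(1 - (1 - w 2) * w 1 ^ 2))⁻¹)) := by
    intro w
    simp only [hTi, he0, he1, he2]
  have hH := soloInformed_legendre_isSemialgebraic_hband hμa
  have hwH : ∀ w ∈ KZlog.band {z : Fin 2 → ℝ | z 0 ∈ Ioo (0:ℝ) 1 ∧ z 1 ∈ Ioo (0:ℝ) 1}
      (fun _ => 0) (fun _ => μ),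
      (0 ≤ w 0 ∧ w 0 ≤ 1) ∧ (0 ≤ w 1 ∧ w 1 ≤ 1) ∧ 0 ≤ w 2 ∧ w 2 < 1 := by
    intro w hw
    rw [soloInformed_legendre_mem_hband] at hw
    exact ⟨⟨hw.1.1.1.le, hw.1.1.2.le⟩, ⟨hw.1.2.1.le, hw.1.2.2.le⟩, hw.2.1, hw.2.2.trans_lt hμ1⟩
  have hsa : IsSemialgebraicFunOn ℚ (KZlog.band {z : Fin 2 → ℝ | z 0 ∈ Ioo (0:ℝ) 1 ∧
      z 1 ∈ Ioo (0:ℝ) 1} (fun _ => 0) (fun _ => μ))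
      (fun w => -(w 0 ^ 2 / 2) * (1 - 2 * w 1 ^ 2 + (1 - w 2) * w 1 ^ 2 * (1 - w 1 ^ 2) /
          (1 - (1 - w 2) * w 1 ^ 2)) *
        ((√(1 - w 0 ^ 2))⁻¹ * (√(1 - w 2 * w 0 ^ 2))⁻¹ *
            ((√(1 - w 1 ^ 2))⁻¹ * (√(1 - (1 - w 2) * w 1 ^ 2))⁻¹))) := by
    refine soloInformed_legendre_sa_mul_kernel 0 1 2 hH hwH ?_
    have hq : ∀ w ∈ KZlog.band {z : Fin 2 → ℝ | z 0 ∈ Ioo (0:ℝ) 1 ∧ z 1 ∈ Ioo (0:ℝ) 1}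
        (fun _ => 0) (fun _ => μ),
        MvPolynomial.aeval w (1 - (1 - MvPolynomial.X 2) * MvPolynomial.X 1 ^ 2 :
          MvPolynomial (Fin 3) ℚ) ≠ 0 := by
      intro w hw
      rw [soloInformed_legendre_mem_hband] at hw
      simp only [map_sub, map_one, map_mul, map_pow, MvPolynomial.aeval_X]
      have : (1 - w 2) * w 1 ^ 2 ≤ 1 * w 1 ^ 2 :=
        mul_le_mul_of_nonneg_right (by linarith [hw.2.1]) (sq_nonneg _)
      nlinarith [hw.1.2.1, hw.1.2.2]
    refine (IsSemialgebraicFunOn.mul_holds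
      (IsSemialgebraicFunOn.mul_holds (isSemialgebraicFunOn_ratCast hH (-1/2))
        (isSemialgebraicFunOn_aeval hH (MvPolynomial.X 0 ^ 2)))
      (IsSemialgebraicFunOn.add_holds
        (isSemialgebraicFunOn_aeval hH (1 - 2 * MvPolynomial.X 1 ^ 2))
        (isSemialgebraicFunOn_aeval_div_aeval hH
          ((1 - MvPolynomial.X 2) * MvPolynomial.X 1 ^ 2 * (1 - MvPolynomial.X 1 ^ 2))
          (1 - (1 - MvPolynomial.X 2) * MvPolynomial.X 1 ^ 2) hq))).congr fun w _ => ?_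
    simp only [Pi.mul_apply, Pi.add_apply, map_mul, map_sub, map_pow, map_one, map_ofNat,
      MvPolynomial.aeval_X]
    push_cast
    ring
  -- `H` and `H⁺` differ by the null face `m = 0`
  have hdiff1 : volume (KZlog.band {z : Fin 2 → ℝ | z 0 ∈ Ioo (0:ℝ) 1 ∧ z 1 ∈ Ioo (0:ℝ) 1}
      (fun _ => 0) (fun _ => μ) \ T.domain) = 0 := by
    refine measure_mono_null (fun w hw => ?_) (by rw [volume_pi]; exact Measure.pi_hyperplane _ 2 0)
    rw [hTd', Set.mem_sdiff, soloInformed_legendre_mem_hband, mem_setOf_eq] at hw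
    simp only [mem_setOf_eq]
    by_contra h
    exact hw.2 ⟨hw.1.1, lt_of_le_of_ne hw.1.2.1 (Ne.symm h), hw.1.2.2⟩
  have hdiff2 : volume (T.domain \ KZlog.band {z : Fin 2 → ℝ | z 0 ∈ Ioo (0:ℝ) 1 ∧
      z 1 ∈ Ioo (0:ℝ) 1} (fun _ => 0) (fun _ => μ)) = 0 := by
    refine measure_mono_null (fun w hw => ?_) measure_empty
    rw [hTd', Set.mem_sdiff, soloInformed_legendre_mem_hband, mem_setOf_eq] at hw
    exact (hw.2 ⟨hw.1.1, hw.1.2.1.le, hw.1.2.2⟩).elim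
  have hintH : IntegrableOn (fun w : Fin 3 → ℝ => -(w 0 ^ 2 / 2) * (1 - 2 * w 1 ^ 2 +
      (1 - w 2) * w 1 ^ 2 * (1 - w 1 ^ 2) / (1 - (1 - w 2) * w 1 ^ 2)) *
        ((√(1 - w 0 ^ 2))⁻¹ * (√(1 - w 2 * w 0 ^ 2))⁻¹ *
            ((√(1 - w 1 ^ 2))⁻¹ * (√(1 - (1 - w 2) * w 1 ^ 2))⁻¹)))
      (KZlog.band {z : Fin 2 → ℝ | z 0 ∈ Ioo (0:ℝ) 1 ∧ z 1 ∈ Ioo (0:ℝ) 1}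
        (fun _ => 0) (fun _ => μ)) := by
    have hI := T.integrableOn
    have hfun : T.integrand = fun w : Fin 3 → ℝ => -(w 0 ^ 2 / 2) * (1 - 2 * w 1 ^ 2 +
        (1 - w 2) * w 1 ^ 2 * (1 - w 1 ^ 2) / (1 - (1 - w 2) * w 1 ^ 2)) *
          ((√(1 - w 0 ^ 2))⁻¹ * (√(1 - w 2 * w 0 ^ 2))⁻¹ *
            ((√(1 - w 1 ^ 2))⁻¹ * (√(1 - (1 - w 2) * w 1 ^ 2))⁻¹)) := funext hTi'
    rw [hfun] at hI
    exact hI.congr_set_ae ((ae_eq_set).2 ⟨hdiff1, hdiff2⟩)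
  set T' : IntegralRep 3 := ⟨KZlog.band {z : Fin 2 → ℝ | z 0 ∈ Ioo (0:ℝ) 1 ∧ z 1 ∈ Ioo (0:ℝ) 1}
      (fun _ => 0) (fun _ => μ), fun w => -(w 0 ^ 2 / 2) * (1 - 2 * w 1 ^ 2 +
      (1 - w 2) * w 1 ^ 2 * (1 - w 1 ^ 2) / (1 - (1 - w 2) * w 1 ^ 2)) *
        ((√(1 - w 0 ^ 2))⁻¹ * (√(1 - w 2 * w 0 ^ 2))⁻¹ *
            ((√(1 - w 1 ^ 2))⁻¹ * (√(1 - (1 - w 2) * w 1 ^ 2))⁻¹)), hH, hsa, hintH⟩ with hT'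
  have hnull : of T' - of T ∈ relations :=
    of_sub_of_mem_relations_of_null T' T hdiff1 hdiff2 fun w _ => (hTi' w).symm
  refine ⟨T', rfl, fun w => rfl, ?_⟩
  have := relations.add_mem hnull hT
  simpa using this

/-! ### Exactness ⇒ relation -/

/-- **`∂_m F` is absolutely integrable on the homotopy band.** [this work] -/
theorem soloInformed_legendre_integrableOn_Fv (μ : ℝ) (hμ : μ ∈ Ioo (0:ℝ) 1)
    (hμa : IsAlgebraic ℚ μ) :
    IntegrableOn (fun w : Fin 3 → ℝ => ((w 1 ^ 2 - w 0 ^ 2) +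
        (1 - w 2 * w 0 ^ 2 - (1 - w 2) * w 1 ^ 2) *
          (w 0 ^ 2 / (2 * (1 - w 2 * w 0 ^ 2)) - w 1 ^ 2 / (2 * (1 - (1 - w 2) * w 1 ^ 2)))) *
        ((√(1 - w 0 ^ 2))⁻¹ * (√(1 - w 2 * w 0 ^ 2))⁻¹ *
          ((√(1 - w 1 ^ 2))⁻¹ * (√(1 - (1 - w 2) * w 1 ^ 2))⁻¹)))
      (KZlog.band {z : Fin 2 → ℝ | z 0 ∈ Ioo (0:ℝ) 1 ∧ z 1 ∈ Ioo (0:ℝ) 1}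
        (fun _ => 0) (fun _ => μ)) := by
  obtain ⟨TA, hAd, hAi, -⟩ := soloInformed_legendre_killA μ hμ hμa
  obtain ⟨TB, hBd, hBi, -⟩ := soloInformed_legendre_killB μ hμ hμa
  have hIA := TA.integrableOn
  have hIB := TB.integrableOn
  rw [hAd] at hIA
  rw [hBd] at hIB
  refine (hIA.add hIB).congr_fun (fun w hw => ?_)
    (IsSemialgebraic.measurableSet_holds (soloInformed_legendre_isSemialgebraic_hband hμa))
  rw [soloInformed_legendre_mem_hband] at hw
  rw [Pi.add_apply, hAi, hBi]
  exact (soloInformed_legendre_certificate hw.1.1 hw.1.2 hw.2.1 (hw.2.2.trans_lt hμ.2) _).symm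

/-- **THEOREM XVII, exactness half: `[H, ∂_m F]` is a relation.**  For `μ ∈ (0,1)` real
algebraic and every representation `rb` on the homotopy band `H = (0,1)² × [0, μ]` whose integrand
agrees on `H` with `∂_m F = [(t² − s²) + (1 − ms² − m't²)(s²/(2(1−ms²)) − t²/(2(1−m't²)))]·k`,
the class of `rb` lies in `KZ.relations`: `∂_m F = ∂_s A + ∂_t B` pointwise (certificate), and
`[H, ∂_s A]`, `[H, ∂_t B]` are relations (the two kills), glued by integrand additivity.
[this work] -/
theorem soloInformed_legendre_exact (μ : ℝ) (hμ : μ ∈ Ioo (0:ℝ) 1) (hμa : IsAlgebraic ℚ μ)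
    (rb : IntegralRep 3)
    (hd : rb.domain = KZlog.band {z : Fin 2 → ℝ | z 0 ∈ Ioo (0:ℝ) 1 ∧ z 1 ∈ Ioo (0:ℝ) 1}
      (fun _ => 0) (fun _ => μ))
    (hi : EqOn rb.integrand (fun w : Fin 3 → ℝ => ((w 1 ^ 2 - w 0 ^ 2) +
        (1 - w 2 * w 0 ^ 2 - (1 - w 2) * w 1 ^ 2) *
          (w 0 ^ 2 / (2 * (1 - w 2 * w 0 ^ 2)) - w 1 ^ 2 / (2 * (1 - (1 - w 2) * w 1 ^ 2)))) *
        ((√(1 - w 0 ^ 2))⁻¹ * (√(1 - w 2 * w 0 ^ 2))⁻¹ *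
          ((√(1 - w 1 ^ 2))⁻¹ * (√(1 - (1 - w 2) * w 1 ^ 2))⁻¹))) rb.domain) :
    of rb ∈ relations := by
  obtain ⟨TA, hAd, hAi, hA⟩ := soloInformed_legendre_killA μ hμ hμa
  obtain ⟨TB, hBd, hBi, hB⟩ := soloInformed_legendre_killB μ hμ hμa
  have hadd : of rb - of TA - of TB ∈ relations := by
    refine integrandAddRel_subset_relations ⟨3, rb, TA, TB, by rw [hAd, hd], by rw [hBd, hd],
      fun w hw => ?_, rfl⟩
    rw [hi hw, Pi.add_apply, hAi, hBi]
    rw [hd, soloInformed_legendre_mem_hband] at hw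
    exact soloInformed_legendre_certificate hw.1.1 hw.1.2 hw.2.1 (hw.2.2.trans_lt hμ.2) _
  have h := relations.add_mem (relations.add_mem hadd hA) hB
  have e : of rb = of rb - of TA - of TB + of TA + of TB := by abel
  rw [e]
  exact h

end Summit.KontsevichZagierPeriods.KontsevichZagierPeriods.Theorems

end
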